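import Summits.QuantumFields.YangMills.Theses.BalabanUVNodes
import Summits.QuantumFields.YangMills.Theorems.BalabanUVNodesN22Road1LocatedWeightFloorVacuous

/-!
# ⚑ A2 CERTIFICATE (dag-n27-c g22) — THE EIGHT K3⁸ LEAVES OVER dag-n22-c's LOCATED ROAD-1 SOCKETS ARE VACUOUS CONCLUDERS

Cell `pub-ymgap`, D-0062 Track A; R134 seat `pub-ymgap-dag-n27-c` (N27 B5 composite, s2), gen 22; K3⁸ `SpineGivenEndpointR13SepCoPHV` = stmt-QuantumFields-27366
(skeleton v7 a85cbf6c34a09649; route decl unchanged), `--kind proof --supports 27366 --as helper`; COUNT-NEUTRAL; THREE theorems, 0 `def`, 0 `sorry`; `N = 2`; route-facing.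

FINDING OF RECORD (dag-n22-c g23 ⚑ LOCATED-A2 «LOCATED ROAD-1 SOCKETS VACUOUS», bus I.46195 07:19Z 2026-08-29, kernel lemma `YMDAG.N22.KernelFading.road1Located_weightRows_false`):
every LOCATED ROAD-1 socket of the N22 lane (J73 `…TermDataTableGermsRoad1Located`, J77 `…Road1LocatedRadii`, J81 `…Road1LocatedRadiiTermSectors`, J81c `…ContinuedTermSectors`,
J81m `…DilatedMembers`, J81p `…MembersOfRecord`, J81r `…MembersOfLocatedRecords`, J81s `…MembersOfLemma2Records`) displays BOTH node N10's located-(2.20) WEIGHT FLOOR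
`0 < b`, `∀ K k j, b ≤ aw K k j` AND ROAD 1's geometric AGE DECAY of the same section weights `∀ K k j, j ≤ k → aw K k j ≤ cw · ω₁ ^ (k − j)` with `ω₁ ≤ μ ≤ ℓ.ω < 1`
(`ℓ.Signs`); at `j = 0` this reads `b ≤ cw · ω₁ ^ k` for every `k`, impossible for `b > 0`.  This lane's EIGHT leaves over those sockets —
`spineGivenEndpointR13SepCoPHV_of_liveV5PinsAtCrOfRecord₁₃VAt_cut_bareLedgerReadingV_kernelFaces_n22TermDataTableGerms{Road1Located (G22 p679235), Road1LocatedRadii (G24 p680882),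
Road1LocatedRadiiTermSectors (G27 p688036), Road1LocatedRadiiContinuedTermSectors (G28 p688830), Road1LocatedRadiiDilatedMembers (G33 p691938), Road1LocatedRadiiMembersOfRecord (G35 p692305),
Road1LocatedRadiiMembersOfLocatedRecords (G37 p695606), Road1LocatedRadiiMembersOfLemma2Records (G39 p703756)}_offLiveOneTerm_v5pins_bFree` — display the same six rows VERBATIM in the
leaves' guarded currency (`x ↦ x F θ` behind `θ.Provisos₁₃CoPH F 2 → (θ.ZhUnity F 2 ∧ θ.SlotsNondegenerate₁₃ F 2) → θ.Admissible F 2`, letters `hs hbw hbaw hawω hω₁μ hμω`).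

WHAT IS KERNEL-CHECKED HERE ([bookkeeping], elementary): §1 `road1LocatedLeafWeightRows_false_at` — those six guarded rows are CONTRADICTORY at every guarded admissible
Stage-13 tuple `(F, θ, hP, hG, hθ)` (J91-V `YMDAG.N22.KernelFading.road1Located_weightRows_false` p706664 BY NAME at the tuple); §2 `spineGivenEndpointR13SepCoPHV_of_forall_guardedTuple_false` — if no guarded admissible tuple exists, K3⁸ holds
with NO further hypothesis (its own antecedents are those guards); §3 `spineGivenEndpointR13SepCoPHV_of_road1LocatedLeafWeightRows` = §2 ∘ §1 — **K3⁸ BY NAME from the six rows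
ALONE**.  CONSEQUENCE FOR THE RECORD: the eight leaves above conclude K3⁸ EX FALSO from 6 of their ≈ 120 displayed binders; the socket, NODE A's located records, def-W1's laws,
the N18 face and every other row they display are IDLE in them; they can be applied only in a world with no guarded admissible Stage-13 tuple, where §2 already gives K3⁸.
They stay TRUE and ACCEPTED (nothing is retracted; the tree is append-only) but carry NO reduction content — table `N27-V6-PIN-REDUCTION-TABLE.md` v6.14 marks them
«VACUOUS (A2)».  NOT affected (no weight floor, or no age decay): the ROAD-2 leaves (J69∕J72∕J74∕J76∕J78∕J79∕J84D∕J85∕J85c∕J86∕J87∕J88∕J89 — `hawcw : aw ≤ cw` only) and the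
non-located ROAD-1 leaves (J55∕J56∕J61∕J65∕J71 — decay without floor); dag-n22-c g23: «located ROAD 1 is DEAD AS TYPED since g19 (J77); ROAD 2's J89 is THE socket of record».
HONEST FRAMING (binding): an A2 (vacuity) certificate about this lane's OWN leaves; nothing of Bałaban's or King's asserted or denied; NOT `stub_rates13HV` ∕ `stub_expansion13HV`;
N22 ∕ N27 NOT discharged; K3⁸ OPEN (stubs 0∕2), NOT claimed — §3 is one more CONDITIONAL concluder whose condition is now known to be EMPTY at every admissible tuple; counts
28∕28 · 8∕27 (A 8∕28) UNMOVED; one finite four-torus programme at fixed `ε` — NOT ℝ⁴, NOT OS, NOT a mass gap, NOT Clay.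
-/

set_option autoImplicit false

namespace Summit.QuantumFields.YangMills.Theorems.BalabanUVNodesN27SpineRecord

open Literature.MathematicalPhysics.QuantumFieldTheory.Balaban1983to89
open Literature.MathematicalPhysics.QuantumFieldTheory.Balaban1983to89.T4Continuum (T4Family)
open Node00 (Stage13HParams U3Letters₁₁)
open Summit.QuantumFields.YangMills.Theses.BalabanUVNodes (SpineGivenEndpointR13SepCoPHV)
open YMDAG.N22.KernelFading (road1Located_weightRows_false)

variable (ℓ : (F : T4Family) → Stage13HParams F 2 → U3Letters₁₁) (cw ω₁ μg bw : (F : T4Family) → Stage13HParams F 2 → ℝ)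
  (aw : (F : T4Family) → Stage13HParams F 2 → ℕ → ℕ → ℕ → ℝ)

/-- §1 **THE SIX GUARDED ROWS ARE CONTRADICTORY AT EVERY GUARDED ADMISSIBLE TUPLE**: the located-(2.20) weight floor `0 < bw ≤ aw K k j` and ROAD 1's age decay
`aw K k j ≤ cw · ω₁ ^ (k − j)` (`j ≤ k`) with `ω₁ ≤ μg ≤ (ℓ F θ).ω < 1` — the rows `hs hbw hbaw hawω hω₁μ hμω` displayed VERBATIM by the eight located ROAD-1 leaves — give
`False` at any `(F, θ)` with provisos, guards and admissibility: ONE application, at the tuple, of dag-n22-c g23's J91-V `YMDAG.N22.KernelFading.road1Located_weightRows_false`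
(p706664; at `j = 0`, `bw ≤ cw · ω₁ ^ k` for every `k`; `k = 0` gives `0 < cw`; `exists_pow_lt_of_lt_one` gives `ω₁ ^ k < bw ∕ cw`; the displayed sign row `0 ≤ ω₁` is not needed) —
the finding of record read in the leaves' guarded currency, BY NAME. [bookkeeping] -/
theorem road1LocatedLeafWeightRows_false_at
    (hs : ∀ (F : T4Family) (θ : Stage13HParams F 2), θ.Provisos₁₃CoPH F 2 → (θ.ZhUnity F 2 ∧ θ.SlotsNondegenerate₁₃ F 2) → θ.Admissible F 2 → (ℓ F θ).Signs)
    (hbw : ∀ (F : T4Family) (θ : Stage13HParams F 2), θ.Provisos₁₃CoPH F 2 → (θ.ZhUnity F 2 ∧ θ.SlotsNondegenerate₁₃ F 2) → θ.Admissible F 2 → 0 < bw F θ)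
    (hbaw : ∀ (F : T4Family) (θ : Stage13HParams F 2), θ.Provisos₁₃CoPH F 2 → (θ.ZhUnity F 2 ∧ θ.SlotsNondegenerate₁₃ F 2) → θ.Admissible F 2 → ∀ K k j, bw F θ ≤ aw F θ K k j)
    (hawω : ∀ (F : T4Family) (θ : Stage13HParams F 2), θ.Provisos₁₃CoPH F 2 → (θ.ZhUnity F 2 ∧ θ.SlotsNondegenerate₁₃ F 2) → θ.Admissible F 2 →
      ∀ K k j, j ≤ k → aw F θ K k j ≤ cw F θ * ω₁ F θ ^ (k - j))
    (hω₁μ : ∀ (F : T4Family) (θ : Stage13HParams F 2), θ.Provisos₁₃CoPH F 2 → (θ.ZhUnity F 2 ∧ θ.SlotsNondegenerate₁₃ F 2) → θ.Admissible F 2 → ω₁ F θ ≤ μg F θ)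
    (hμω : ∀ (F : T4Family) (θ : Stage13HParams F 2), θ.Provisos₁₃CoPH F 2 → (θ.ZhUnity F 2 ∧ θ.SlotsNondegenerate₁₃ F 2) → θ.Admissible F 2 → μg F θ ≤ (ℓ F θ).ω)
    (F : T4Family) (θ : Stage13HParams F 2) (hP : θ.Provisos₁₃CoPH F 2) (hG : θ.ZhUnity F 2 ∧ θ.SlotsNondegenerate₁₃ F 2) (hθ : θ.Admissible F 2) : False :=
  road1Located_weightRows_false (ℓ F θ) (hs F θ hP hG hθ) (hbw F θ hP hG hθ) (hbaw F θ hP hG hθ) (hawω F θ hP hG hθ) (hω₁μ F θ hP hG hθ) (hμω F θ hP hG hθ)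

/-- §2 **K3⁸ IS FREE IN A WORLD WITHOUT GUARDED ADMISSIBLE TUPLES**: `SpineGivenEndpointR13SepCoPHV`'s own antecedents are the provisos (`h.toCore`), the guards
`θ.ZhUnity ∧ θ.SlotsNondegenerate₁₃` and `θ.Admissible`; if these are jointly empty at every `(F, θ)`, the item holds with nothing else said.  (The A2 face of K3⁸: any
leaf whose displayed rows are contradictory at every such tuple — §1 — is applicable only here.) [bookkeeping] -/
theorem spineGivenEndpointR13SepCoPHV_of_forall_guardedTuple_false
    (hempty : ∀ (F : T4Family) (θ : Stage13HParams F 2), θ.Provisos₁₃CoPH F 2 → (θ.ZhUnity F 2 ∧ θ.SlotsNondegenerate₁₃ F 2) → θ.Admissible F 2 → False) :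
    SpineGivenEndpointR13SepCoPHV :=
  fun F θ h _ hG hθ => (hempty F θ h.toCore hG hθ).elim

/-- §3 ★ **`SpineGivenEndpointR13SepCoPHV` BY NAME FROM THE SIX ROWS ALONE** (§2 ∘ §1): the conclusion of each of the eight located ROAD-1 leaves already follows from
the rows `hs hbw hbaw hawω hω₁μ hμω` they display — EX FALSO per guarded admissible tuple; their socket row `h22'`, NODE A's located records, def-W1's laws, the N18 face
and every other binder are idle.  A CONDITIONAL concluder whose condition is EMPTY at every admissible tuple; NOT a reduction of K3⁸ to anything; K3⁸ OPEN. [bookkeeping] -/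
theorem spineGivenEndpointR13SepCoPHV_of_road1LocatedLeafWeightRows
    (hs : ∀ (F : T4Family) (θ : Stage13HParams F 2), θ.Provisos₁₃CoPH F 2 → (θ.ZhUnity F 2 ∧ θ.SlotsNondegenerate₁₃ F 2) → θ.Admissible F 2 → (ℓ F θ).Signs)
    (hbw : ∀ (F : T4Family) (θ : Stage13HParams F 2), θ.Provisos₁₃CoPH F 2 → (θ.ZhUnity F 2 ∧ θ.SlotsNondegenerate₁₃ F 2) → θ.Admissible F 2 → 0 < bw F θ)
    (hbaw : ∀ (F : T4Family) (θ : Stage13HParams F 2), θ.Provisos₁₃CoPH F 2 → (θ.ZhUnity F 2 ∧ θ.SlotsNondegenerate₁₃ F 2) → θ.Admissible F 2 → ∀ K k j, bw F θ ≤ aw F θ K k j)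
    (hawω : ∀ (F : T4Family) (θ : Stage13HParams F 2), θ.Provisos₁₃CoPH F 2 → (θ.ZhUnity F 2 ∧ θ.SlotsNondegenerate₁₃ F 2) → θ.Admissible F 2 →
      ∀ K k j, j ≤ k → aw F θ K k j ≤ cw F θ * ω₁ F θ ^ (k - j))
    (hω₁μ : ∀ (F : T4Family) (θ : Stage13HParams F 2), θ.Provisos₁₃CoPH F 2 → (θ.ZhUnity F 2 ∧ θ.SlotsNondegenerate₁₃ F 2) → θ.Admissible F 2 → ω₁ F θ ≤ μg F θ)
    (hμω : ∀ (F : T4Family) (θ : Stage13HParams F 2), θ.Provisos₁₃CoPH F 2 → (θ.ZhUnity F 2 ∧ θ.SlotsNondegenerate₁₃ F 2) → θ.Admissible F 2 → μg F θ ≤ (ℓ F θ).ω) :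
    SpineGivenEndpointR13SepCoPHV :=
  spineGivenEndpointR13SepCoPHV_of_forall_guardedTuple_false (road1LocatedLeafWeightRows_false_at ℓ cw ω₁ μg bw aw hs hbw hbaw hawω hω₁μ hμω)

end Summit.QuantumFields.YangMills.Theorems.BalabanUVNodesN27SpineRecord
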